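import Summits.BirchSwinnertonDyer.BirchSwinnertonDyer.Theorems.KolyvaginRoadThreeSchneiderTamAtThreeHeightLogNumeratorScale
import HarnessLib

/-!
# Crux `SchneiderTamAtThree` (item 19154) — THE HEIGHT IS THE LOGARITHM OF THE NUMERATOR, part 3/4:
# the main theorem `‖x(P)·Σ²_E(P) − 1‖₃ ≤ ‖x(P)‖₃⁻¹`

HONEST FRAMING (cell `bsd-stepL`, seat `bsd-stepL-tam3-p2` g0, WIDTH-LEVER second lane «closed-form Schneider
local factor at 3»; `--supports stmt-BirchSwinnertonDyer-19154 --as helper`): THEOREMS ONLY, unconditional,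
route-independent (no Theses import); 0 definitions, 0 named facts, 0 sorry; nothing here proves the
crux `SchneiderTamAtThree`, Schneider's conjecture or BSD. Objects: ui-o2's `Σ²_E(P) = tateSigmaValueSq`
(`Uniform/UI/O2.lean`), SW's height (4.1) `heightFourOneCoord`, the tree's formal logarithm
`padicFormalLog`, `coshOfSq`, `tateSigmaSq`, `uniformisationScaleSq`.

* `norm_x_mul_tateSigmaValueSq_sub_one_le` — for `W/ℚ` globally minimal with multiplicative reduction at
  `3`, any `q ∈ ℚ₃` with `‖q‖₃ < 1`, and any rational point `P = (x,y)` with `‖x‖₃ > 1`: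
  **`‖x·Σ²_E(P) − 1‖₃ ≤ ‖x‖₃⁻¹`**, i.e. `x(P)·Σ²_E(P) ≡ 1 (mod 3^{2k})` where `3^{2k} ‖ den x(P)`.
  Consequences (part 4, `…HeightLogNumeratorCriterion.lean`): `ĥ₃(P) = log₃ num x(P) + O(‖x‖⁻¹)`,
  `‖ĥ₃(P)‖ = ‖(num x)² − 1‖` whenever this exceeds `‖x‖⁻¹`, hence the NUMERATOR CRITERION
  `3^{v₃(den x)} ∤ (num x)² − 1 ⟹ ĥ₃(P) ≠ 0 ⟹` (rank one) Schneider at `3`.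

Proof outline (`z = −x/y`, `ℓ = log_W z`, `C2 = C²`, `L = ℓ²/C2`, `c = ch L`, `Π` the `q`-product,
`Σ² = C2·2(c−1)·Π` by `rfl`): (A) `x z² = 1 − a₁z + ρ`, `‖ρ‖ ≤ ‖z‖²`; (B) `ℓ = z + w`,
`w = ½a₁z² + ⅓(a₁²+a₂)z³ + τ`, `‖τ‖ ≤ ‖z‖⁴`, `‖w‖ ≤ ‖z‖²`; (C) `xℓ² = 1 + ⅔(a₁²+a₂)z² + G`, `‖G‖ ≤ ‖z‖²`
(an exact polynomial identity + ultrametric bookkeeping); (D) the key cancellation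
`‖⅔(a₁²+a₂)z² + L/12‖ ≤ ‖z‖²` from `‖8(a₁²+a₂)C2 + 1‖ ≤ 3⁻¹` (part 2) and `‖ℓ² − z²‖ ≤ ‖z‖³`;
(E) `2(c − 1) = L + L²/12 + D`, `‖D‖ ≤ 9‖L‖³` (part 1), whence `M := x·C2·2(c−1)` has `‖M − 1‖ ≤ ‖z‖²`;
(F) `x·Σ² − 1 = (M − 1) + M(Π − 1)` with `‖Π − 1‖ ≤ ‖q‖‖c − 1‖ ≤ ‖z‖²` (part 1).

References: [SteinWuthrich2013] §4.1 (4.1), §4.2; [SilvermanAEC2009] IV.1, IV.5–6, VII.2;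
[Iwasawa1972PadicL] §4.4; ui-o2 `Uniform/UI/O2SigmaNormalisation.lean` (first-order version).
-/

noncomputable section

open scoped Classical Nat
open Filter Topology IsUltrametricDist PowerSeries
open WeierstrassCurve Literature.NumberTheory.EllipticCurves
open Literature.NumberTheory.EllipticCurves.SteinWuthrich2013
open Literature.NumberTheory.EllipticCurves.TateCurve
open Literature.NumberTheory.EllipticCurves.Rank1Residual
open Summit.BirchSwinnertonDyer.Uniform.UI.O2

namespace Summit.BirchSwinnertonDyer.Rank1Residual.X11b.RegMult.HeightLogNumerator

/-! ### §6 MAIN THEOREM: `x(P)·Σ²_E(P) ≡ 1 (mod 3^{2k})`, `3^{2k} ‖ den x(P)` -/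

section Main

variable {W : WeierstrassCurve ℚ}

/-- **MAIN THEOREM: `x(P)·Σ²_E(P) ≡ 1` to the full depth of the point.** For `W/ℚ` globally minimal with
multiplicative reduction at `3`, ANY `q ∈ ℚ₃` with `‖q‖₃ < 1` and any rational affine point `P = (x, y)`
with `‖x‖₃ > 1` (the `E₁(ℚ₃)` condition): `‖x·Σ²_E(P) − 1‖₃ ≤ ‖x‖₃⁻¹` (`= ‖z(P)‖₃²`, `= ‖den x(P)‖₃`).
Mechanism (tree transcription `Σ² = C²·2(ch L − 1)·Π`, `L = log_W(z)²/C²`, `z = −x/y`): to second order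
`x z² = 1 − a₁z + O(z²)` (equation), `log_W z = z + ½a₁z² + ⅓(a₁²+a₂)z³ + O(z⁴)`,
`2(ch L − 1) = L + L²/12 + O(L³)`, `Π = 1 + O(qL)`; the `a₁z` terms cancel identically, and the two
non-integral `z²/3` terms — `⅔(a₁²+a₂)z²` from the logarithm and `z²/(12C²)` from `ch` — cancel
MODULO 3 by the scale congruence `8(a₁²+a₂)C² ≡ −1` (part 2). ui-o2 (gen 8) had the first-order
statement `‖x·Σ² − 1‖ < 1`; this is its sharpening to relative precision `‖x‖⁻¹`.
[cite: SteinWuthrich2013, §4.2] [cite: SilvermanAEC2009, IV.1, IV.6.4, VII.2.2] -/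
theorem norm_x_mul_tateSigmaValueSq_sub_one_le [W.IsElliptic] [W.IsGloballyMinimal] (hW : Mult W 3)
    {q : ℚ_[3]} (hq : ‖q‖ < 1) {x y : ℚ} (hxy : W.toAffine.Nonsingular x y)
    (hx : 1 < ‖(x : ℚ_[3])‖) :
    ‖(x : ℚ_[3]) * tateSigmaValueSq W 3 q x y - 1‖ ≤ ‖(x : ℚ_[3])‖⁻¹ := by
  -- the objects (as in ui-o2's `norm_x_mul_tateSigmaValueSq_sub_one_lt_one`)
  set X : ℚ_[3] := (x : ℚ_[3]) with hXdef
  set Y : ℚ_[3] := (y : ℚ_[3]) with hYdef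
  set V : WeierstrassCurve ℚ_[3] := W.baseChange ℚ_[3] with hVdef
  set z : ℚ_[3] := -X / Y with hzdef
  set ℓ : ℚ_[3] := V.padicFormalLog z with hℓdef
  set C2 : ℚ_[3] := uniformisationScaleSq W 3 q with hC2def
  set L : ℚ_[3] := logUnitParamSq W 3 q x y with hLdef
  set c : ℚ_[3] := coshOfSq L with hcdef
  set Pr : ℚ_[3] := ∏' n : ℕ, (1 - 2 * q ^ (n + 1) * c + q ^ (2 * (n + 1))) ^ 2 /
    (1 - q ^ (n + 1)) ^ 4 with hPrdef
  have hSig : tateSigmaValueSq W 3 q x y = C2 * (2 * (c - 1) * Pr) := rfl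
  have hL : L = ℓ ^ 2 / C2 := rfl
  -- basic norms
  obtain ⟨hz, hz2⟩ := norm_neg_div_of_one_lt_norm (p := 3) hxy hx
  have hz3 : ‖z‖ ≤ 1 / 3 := hz.trans (by norm_num)
  have hX0 : 0 < ‖X‖ := one_pos.trans hx
  have hX0' : X ≠ 0 := norm_pos_iff.mp hX0
  have hXz : ‖X‖ * ‖z‖ ^ 2 = 1 := by rw [hz2, mul_inv_cancel₀ hX0.ne']
  have hXinv : ‖X‖⁻¹ = ‖z‖ ^ 2 := hz2.symm
  have hzz : 0 < ‖z‖ := by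
    have h : 0 < ‖z‖ ^ 2 := by rw [hz2]; exact inv_pos.mpr hX0
    rcases (norm_nonneg z).eq_or_lt with h0 | h0
    · rw [← h0] at h; norm_num at h
    · exact h0
  -- small numeric facts about `r = ‖z‖ ∈ (0, 1/3]` (kept out of the heavy context below)
  have num : ∀ r : ℝ, 0 < r → r ≤ 1 / 3 →
      r ≤ 1 ∧ 3 * r ≤ 1 ∧ r ^ 2 ≤ r ∧ r ^ 2 < r ∧ r ^ 2 ≤ 1 ∧ 9 * r ^ 2 ≤ 1 ∧ r ^ 2 ≤ 1 / 9 ∧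
        r ^ 3 ≤ r ^ 2 * (1 / 3) := by
    intro r h0 h3
    refine ⟨by linarith, by linarith, by nlinarith, by nlinarith, by nlinarith, by nlinarith, by nlinarith, ?_⟩
    nlinarith [sq_nonneg r]
  obtain ⟨hz1, h3z, hz2le, hz2lt, hz2le1, h9z, hz29, hz3le⟩ := num ‖z‖ hzz hz3
  obtain ⟨ha1, ha2, -, -, -⟩ := V.norm_coeffs_le_one
  have hC : ‖C2‖ = 1 := norm_uniformisationScaleSq_eq_one hW hq
  have hC0 : C2 ≠ 0 := norm_pos_iff.mp (by rw [hC]; exact one_pos)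
  have heq : V.toAffine.Equation X Y := (nonsingular_ratCast (p := 3) hxy).left
  obtain ⟨-, hxyn⟩ := V.norm_sq_eq_norm_cube heq hx
  have hY0 : Y ≠ 0 := by
    intro h; rw [h, norm_zero] at hxyn; linarith [norm_nonneg X]
  have h2n : ‖(2 : ℚ_[3])‖ = 1 := by
    simpa using Padic.norm_natCast_eq_one_iff.mpr (show Nat.Coprime 3 2 by decide)
  have h2i : ‖(2 : ℚ_[3])⁻¹‖ = 1 := by rw [norm_inv, h2n, inv_one]
  have h3i : ‖(3 : ℚ_[3])⁻¹‖ = 3 := by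
    rw [norm_inv, show (3 : ℚ_[3]) = ((3 : ℕ) : ℚ_[3]) by norm_cast, Padic.norm_p]; norm_num
  have h12i : ‖(12 : ℚ_[3])⁻¹‖ = 3 := by
    rw [show (12 : ℚ_[3]) = ((4 : ℤ) : ℚ_[3]) * 3 by norm_num, mul_inv, norm_mul, h3i, norm_inv,
      Padic.norm_intCast_eq_one_iff.mpr (by norm_num), inv_one, one_mul]
  -- Step A: `X z² = 1 − a₁ z + ρ`, `‖ρ‖ ≤ ‖z‖²`
  set ρ : ℚ_[3] := X * z ^ 2 - 1 + V.a₁ * z with hρdef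
  have hρ : ‖ρ‖ ≤ ‖z‖ ^ 2 := by
    have e : ρ = X ^ 3 / Y ^ 2 - 1 - V.a₁ * (X / Y) := by
      rw [hρdef, hzdef]; field_simp; ring
    rw [e, ← hXinv]
    exact norm_pow_three_div_sq_sub_le heq hx
  -- Step B: `ℓ = z + w`, `w = ½a₁z² + ⅓(a₁²+a₂)z³ + τ`, `‖τ‖ ≤ ‖z‖⁴`, `‖w‖ ≤ ‖z‖²`
  set B2 : ℚ_[3] := 2 * (3 : ℚ_[3])⁻¹ * (V.a₁ ^ 2 + V.a₂) with hB2def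
  set τ : ℚ_[3] := ℓ - (z + (2 : ℚ_[3])⁻¹ * V.a₁ * z ^ 2 + (3 : ℚ_[3])⁻¹ * (V.a₁ ^ 2 + V.a₂) * z ^ 3)
    with hτdef
  have hτ : ‖τ‖ ≤ ‖z‖ ^ 4 := norm_padicFormalLog_sub_cubic_le_pow_four V hz3
  set w : ℚ_[3] := ℓ - z with hwdef
  have hw_eq : w = (2 : ℚ_[3])⁻¹ * V.a₁ * z ^ 2 + (3 : ℚ_[3])⁻¹ * (V.a₁ ^ 2 + V.a₂) * z ^ 3 + τ := by
    rw [hwdef, hτdef]; ring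
  have ha12 : ‖V.a₁ ^ 2 + V.a₂‖ ≤ 1 :=
    (norm_add_le_max _ _).trans (max_le (by rw [norm_pow]; exact pow_le_one₀ (norm_nonneg _) ha1) ha2)
  have hB2 : ‖B2‖ ≤ 3 := by
    rw [hB2def, norm_mul, norm_mul, h2n, h3i, one_mul]
    calc 3 * ‖V.a₁ ^ 2 + V.a₂‖ ≤ 3 * 1 := by gcongr
      _ = 3 := mul_one _
  have hw : ‖w‖ ≤ ‖z‖ ^ 2 := by
    rw [hw_eq]
    refine (norm_add_le_max _ _).trans (max_le ((norm_add_le_max _ _).trans (max_le ?_ ?_)) ?_)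
    · rw [norm_mul, norm_mul, h2i, one_mul, norm_pow]
      calc ‖V.a₁‖ * ‖z‖ ^ 2 ≤ 1 * ‖z‖ ^ 2 := by gcongr
        _ = ‖z‖ ^ 2 := one_mul _
    · rw [norm_mul, norm_mul, h3i, norm_pow]
      calc 3 * ‖V.a₁ ^ 2 + V.a₂‖ * ‖z‖ ^ 3 ≤ 3 * 1 * ‖z‖ ^ 3 := by gcongr
        _ = (3 * ‖z‖) * ‖z‖ ^ 2 := by ring
        _ ≤ 1 * ‖z‖ ^ 2 := by gcongr
        _ = ‖z‖ ^ 2 := one_mul _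
    · calc ‖τ‖ ≤ ‖z‖ ^ 4 := hτ
        _ = ‖z‖ ^ 2 * ‖z‖ ^ 2 := by ring
        _ ≤ 1 * ‖z‖ ^ 2 := by gcongr
        _ = ‖z‖ ^ 2 := one_mul _
  have hℓzw : ℓ = z + w := by rw [hwdef]; ring
  have hℓpz : ‖ℓ + z‖ ≤ ‖z‖ := by
    rw [hℓzw, show z + w + z = w + 2 * z by ring]
    refine (norm_add_le_max _ _).trans (max_le (hw.trans hz2le) ?_)
    rw [norm_mul, h2n, one_mul]
  have hℓ2z2 : ‖ℓ ^ 2 - z ^ 2‖ ≤ ‖z‖ ^ 3 := by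
    rw [show ℓ ^ 2 - z ^ 2 = (ℓ - z) * (ℓ + z) by ring, norm_mul, ← hwdef]
    calc ‖w‖ * ‖ℓ + z‖ ≤ ‖z‖ ^ 2 * ‖z‖ := by gcongr
      _ = ‖z‖ ^ 3 := by ring
  have hℓn : ‖ℓ‖ = ‖z‖ := by
    rw [hℓzw]
    have hlt : ‖w‖ < ‖z‖ := lt_of_le_of_lt hw hz2lt
    rw [norm_add_eq_max_of_norm_ne_norm hlt.ne', max_eq_left hlt.le]
  have hLn : ‖L‖ = ‖z‖ ^ 2 := by rw [hL, norm_div, norm_pow, hℓn, hC, div_one]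
  have hL9 : ‖L‖ ≤ 1 / 9 := by rw [hLn]; exact hz29
  -- Step C: `X ℓ² = 1 + B2 z² + G`, `‖G‖ ≤ ‖z‖²`
  set G : ℚ_[3] := X * ℓ ^ 2 - 1 - B2 * z ^ 2 with hGdef
  have hGid : G = ρ + (V.a₁ * z + B2 * z ^ 2) * (X * z ^ 2 - 1) + 2 * X * z * τ + X * w ^ 2 := by
    have hτw : τ = w - (2 : ℚ_[3])⁻¹ * V.a₁ * z ^ 2 - (3 : ℚ_[3])⁻¹ * (V.a₁ ^ 2 + V.a₂) * z ^ 3 := by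
      rw [hw_eq]; ring
    rw [hGdef, hρdef, hτw, hℓzw, hB2def]
    ring
  have hXz1 : ‖X * z ^ 2 - 1‖ ≤ ‖z‖ := by
    rw [show X * z ^ 2 - 1 = ρ - V.a₁ * z by rw [hρdef]; ring]
    refine (norm_sub_le_max₃ _ _).trans (max_le (hρ.trans hz2le) ?_)
    rw [norm_mul]
    calc ‖V.a₁‖ * ‖z‖ ≤ 1 * ‖z‖ := by gcongr
      _ = ‖z‖ := one_mul _
  have haB : ‖V.a₁ * z + B2 * z ^ 2‖ ≤ ‖z‖ := by
    refine (norm_add_le_max _ _).trans (max_le ?_ ?_)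
    · rw [norm_mul]
      calc ‖V.a₁‖ * ‖z‖ ≤ 1 * ‖z‖ := by gcongr
        _ = ‖z‖ := one_mul _
    · rw [norm_mul, norm_pow]
      calc ‖B2‖ * ‖z‖ ^ 2 ≤ 3 * ‖z‖ ^ 2 := by gcongr
        _ = (3 * ‖z‖) * ‖z‖ := by ring
        _ ≤ 1 * ‖z‖ := by gcongr
        _ = ‖z‖ := one_mul _
  have hG : ‖G‖ ≤ ‖z‖ ^ 2 := by
    rw [hGid]
    refine (norm_add_le_max _ _).trans (max_le ((norm_add_le_max _ _).trans (max_le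
      ((norm_add_le_max _ _).trans (max_le hρ ?_)) ?_)) ?_)
    · rw [norm_mul]
      calc ‖V.a₁ * z + B2 * z ^ 2‖ * ‖X * z ^ 2 - 1‖ ≤ ‖z‖ * ‖z‖ := by gcongr
        _ = ‖z‖ ^ 2 := by ring
    · rw [norm_mul, norm_mul, norm_mul, h2n, one_mul]
      calc ‖X‖ * ‖z‖ * ‖τ‖ ≤ ‖X‖ * ‖z‖ * ‖z‖ ^ 4 := by gcongr
        _ = (‖X‖ * ‖z‖ ^ 2) * ‖z‖ * ‖z‖ ^ 2 := by ring
        _ = ‖z‖ * ‖z‖ ^ 2 := by rw [hXz, one_mul]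
        _ ≤ 1 * ‖z‖ ^ 2 := by gcongr
        _ = ‖z‖ ^ 2 := one_mul _
    · rw [norm_mul, norm_pow]
      calc ‖X‖ * ‖w‖ ^ 2 ≤ ‖X‖ * (‖z‖ ^ 2) ^ 2 := by gcongr
        _ = (‖X‖ * ‖z‖ ^ 2) * ‖z‖ ^ 2 := by ring
        _ = ‖z‖ ^ 2 := by rw [hXz, one_mul]
  -- Step D: the key cancellation `‖B2 z² + L/12‖ ≤ ‖z‖²`
  have hS : ‖8 * (V.a₁ ^ 2 + V.a₂) * C2 + 1‖ ≤ 1 / 3 := norm_eight_mul_scaleSq_add_one_le hW hq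
  have hKid : B2 * z ^ 2 + L / 12 =
      (12 * C2)⁻¹ * (z ^ 2 * (8 * (V.a₁ ^ 2 + V.a₂) * C2 + 1) + (ℓ ^ 2 - z ^ 2)) := by
    rw [hL, hB2def]
    field_simp
    ring
  have hK : ‖B2 * z ^ 2 + L / 12‖ ≤ ‖z‖ ^ 2 := by
    rw [hKid, norm_mul, norm_inv, norm_mul, hC, mul_one, show ‖(12 : ℚ_[3])‖⁻¹ = 3 by
      rw [← norm_inv, h12i]]
    have h1 : ‖z ^ 2 * (8 * (V.a₁ ^ 2 + V.a₂) * C2 + 1)‖ ≤ ‖z‖ ^ 2 * (1 / 3) := by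
      rw [norm_mul, norm_pow]; gcongr
    have h2 : ‖ℓ ^ 2 - z ^ 2‖ ≤ ‖z‖ ^ 2 * (1 / 3) := hℓ2z2.trans hz3le
    calc 3 * ‖z ^ 2 * (8 * (V.a₁ ^ 2 + V.a₂) * C2 + 1) + (ℓ ^ 2 - z ^ 2)‖
        ≤ 3 * (‖z‖ ^ 2 * (1 / 3)) := by
          gcongr; exact (norm_add_le_max _ _).trans (max_le h1 h2)
      _ = ‖z‖ ^ 2 := by ring
  -- Step E: `cosh` to second order and the assembly of `M = X·C2·2(c − 1)`
  set D : ℚ_[3] := 2 * (c - 1) - L - L ^ 2 / 12 with hDdef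
  have hD : ‖D‖ ≤ 9 * ‖L‖ ^ 3 := norm_two_mul_coshOfSq_sub_one_sub_sub_le hL9
  set M : ℚ_[3] := X * C2 * (2 * (c - 1)) with hMdef
  have hMid : M - 1 = (B2 * z ^ 2 + L / 12) + (B2 * z ^ 2 + G) * (L / 12) + G + X * C2 * D := by
    have hCL : C2 * L = ℓ ^ 2 := by rw [hL]; field_simp
    have hXℓ : X * ℓ ^ 2 = 1 + B2 * z ^ 2 + G := by rw [hGdef]; ring
    have h2c : 2 * (c - 1) = L + L ^ 2 / 12 + D := by rw [hDdef]; ring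
    rw [hMdef, h2c]
    have : X * C2 * (L + L ^ 2 / 12 + D) = X * (C2 * L) * (1 + L / 12) + X * C2 * D := by ring
    rw [this, hCL, hXℓ]
    ring
  have hL12 : ‖L / 12‖ = 3 * ‖z‖ ^ 2 := by rw [div_eq_mul_inv, norm_mul, h12i, hLn, mul_comm]
  have hM1 : ‖M - 1‖ ≤ ‖z‖ ^ 2 := by
    rw [hMid]
    refine (norm_add_le_max _ _).trans (max_le ((norm_add_le_max _ _).trans (max_le
      ((norm_add_le_max _ _).trans (max_le hK ?_)) hG)) ?_)
    · rw [norm_mul, hL12]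
      have hBG : ‖B2 * z ^ 2 + G‖ ≤ 3 * ‖z‖ ^ 2 := by
        refine (norm_add_le_max _ _).trans (max_le ?_ (hG.trans (by linarith [hG, norm_nonneg G])))
        rw [norm_mul, norm_pow]; gcongr
      calc ‖B2 * z ^ 2 + G‖ * (3 * ‖z‖ ^ 2) ≤ (3 * ‖z‖ ^ 2) * (3 * ‖z‖ ^ 2) := by gcongr
        _ = (9 * ‖z‖ ^ 2) * ‖z‖ ^ 2 := by ring
        _ ≤ 1 * ‖z‖ ^ 2 := by gcongr
        _ = ‖z‖ ^ 2 := one_mul _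
    · rw [norm_mul, norm_mul, hC, mul_one]
      calc ‖X‖ * ‖D‖ ≤ ‖X‖ * (9 * ‖L‖ ^ 3) := by gcongr
        _ = 9 * (‖X‖ * ‖z‖ ^ 2) * (‖z‖ ^ 2 * ‖z‖ ^ 2) := by rw [hLn]; ring
        _ = (9 * ‖z‖ ^ 2) * ‖z‖ ^ 2 := by rw [hXz]; ring
        _ ≤ 1 * ‖z‖ ^ 2 := by gcongr
        _ = ‖z‖ ^ 2 := one_mul _
  -- Step F: the product `Π = 1 + O(q (c − 1))` and the end
  have hc1 : ‖c - 1‖ ≤ ‖L‖ := by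
    have hL' : ‖L‖ ≤ ((3 : ℝ)⁻¹) ^ 2 := hL9.trans (by norm_num)
    obtain ⟨R, hR, hRle⟩ := coshOfSq_eq_one_add_half_add (p := 3) (by norm_num) hL'
    rw [hcdef, hR, show 1 + L / 2 + R - 1 = L / 2 + R by ring]
    refine (norm_add_le_max _ _).trans (max_le ?_ (hRle.trans ?_))
    · rw [div_eq_mul_inv, norm_mul, h2i, mul_one]
    · calc ‖L‖ * ((3 : ℕ) : ℝ)⁻¹ ≤ ‖L‖ * 1 := by gcongr; norm_num
        _ = ‖L‖ := mul_one _
  have hcn : ‖c‖ ≤ 1 := by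
    have hL' : ‖L‖ ≤ ((3 : ℝ)⁻¹) ^ 2 := hL9.trans (by norm_num)
    exact (norm_coshOfSq_eq_one (p := 3) (by norm_num) hL').le
  have hPr : ‖Pr - 1‖ ≤ ‖z‖ ^ 2 := by
    have hq1 : ‖q‖ ≤ 1 := hq.le
    refine (norm_tprod_tateSigmaSq_factor_sub_one_le_mul hq hcn).trans ?_
    calc ‖q‖ * ‖c - 1‖ ≤ 1 * ‖L‖ := by gcongr
      _ = ‖z‖ ^ 2 := by rw [one_mul, hLn]
  have hMn : ‖M‖ ≤ 1 := by
    rw [show M = 1 + (M - 1) by ring]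
    exact (norm_add_le_max _ _).trans (max_le (by simp) (hM1.trans hz2le1))
  have hfin : X * tateSigmaValueSq W 3 q x y - 1 = (M - 1) + M * (Pr - 1) := by
    rw [hSig, hMdef]; ring
  rw [hfin, hXinv]
  refine (norm_add_le_max _ _).trans (max_le hM1 ?_)
  rw [norm_mul]
  calc ‖M‖ * ‖Pr - 1‖ ≤ 1 * ‖z‖ ^ 2 := by gcongr
    _ = ‖z‖ ^ 2 := one_mul _

end Main




end Summit.BirchSwinnertonDyer.Rank1Residual.X11b.RegMult.HeightLogNumerator

end
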